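import Literature.MathematicalPhysics.QuantumLattice.FermiRG.FSTInversionConvexSurface

/-!
# Feldman–Salmhofer–Trubowitz IV — Lemma 1 for plane curves: curvature bounds ⇒ rolling balls
# (Blaschke's rolling theorem in `d = 2`) — PROOF

J. Feldman, M. Salmhofer, E. Trubowitz, *An inversion theorem in Fermi surface theory*, CPAM **53**
(2000) 1350–1384 = arXiv:math-ph/0001031 [FeldmanSalmhoferTrubowitz2000], §2.1 Lemma 1 (p.6:L29–57)
and its Appendix (p.19:L1–p.20:L34); render `paper:arxiv-math-ph_0001031`, locators `p.N:Ln`.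

`FermiRG/FSTInversionConvexSurface.lean` proves the four conclusions of Lemma 1 for the rolling-ball
surface class `FST4.RollingConvexBody k K B n` and leaves the implication "`C²` convex surface with all
principal curvatures in `[k, K]` ⇒ rolling balls" (Blaschke, [B] §24 of the source) as
`TODO(general form)`.  THIS FILE proves that implication in the plane (`d = 2`, the dimension of the
`gate-hubbard-kl` programme), so that Lemma 1 holds there from the printed curvature hypothesis.

## The `d = 2` hypothesis, and why it is the printed one

A closed `C²` convex curve `S ⊂ ℝ² ≅ ℂ` with curvature `κ ∈ [k, K]`, `k > 0`, is parametrised by the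
angle `φ` of its outward normal `e(φ) = (cos φ, sin φ)` (the Gauss map is a `C¹` diffeomorphism onto
the circle because `κ > 0`): `S = {γ(φ)}`, `γ(φ) = h(φ) e(φ) + h′(φ) e′(φ)`, where
`h(φ) = max_{p ∈ S} ⟪p, e(φ)⟫ = ⟪γ(φ), e(φ)⟫` is the SUPPORT FUNCTION, `2π`-periodic and `C²`, and
`γ′(φ) = (h(φ) + h″(φ)) e′(φ)`, so the radius of curvature is `ρ(φ) = 1/κ = h(φ) + h″(φ)`.  Conversely
every `2π`-periodic `C²` function `h` with `h + h″ > 0` arises this way.  Hence, in `d = 2`,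
"`C²` convex, curvature in `[k, K]`" ⟺ "`h ∈ C²`, `2π`-periodic, `1/K ≤ h + h″ ≤ 1/k`", and the region
bounded by `S` is `B = {x : ∀ ψ, ⟪x, e(ψ)⟫ ≤ h(ψ)}` (`supportBody h`).  We take the right-hand side as
the hypothesis (the classical reparametrisation itself is not formalised) and PROVE:

* `supportBody_subset_closedBall` / `closedBall_subset_supportBody`: the OUTER ball of radius `1/k` and
  the INNER ball of radius `1/K` at every point `γ(φ)`, i.e. Blaschke's rolling theorem for plane
  curves — by a Sturm comparison argument (`sturm_nonneg`: `g″ + g = f ≥ 0`, `g(a) = g′(a) = 0` ⇒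
  `g ≥ 0` on `[a − π, a + π]`, via the explicit solution `∫ₐ^ψ sin(ψ − s) f(s) ds` and uniqueness by
  the energy `g² + g′²`), applied to `g(ψ) = ±(h(ψ) − ⟪γ(φ), e(ψ)⟫ − r(1 − cos(ψ − φ)))`, `r = 1/K, 1/k`;
* `frontier_supportBody`: `frontier B = S = range γ`;
* `rollingConvexBody_supportBody`: `B` with the normal field `e ∘ γ⁻¹` IS a `RollingConvexBody k K`;
* `lemma1_plane`: FST IV Lemma 1 for such curves, from `FST4.lemma1`;
* `lemma1_plane_symmetric` (rev 2): the centrally symmetric case `h(φ + π) = h(φ)` — centre `0`,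
  `1/K ≤ ‖γ(φ)‖ ≤ 1/k`, `h(φ) ≥ (k/K)‖γ(φ)‖` — the form FST IV's Lemma 2 extracts (App. p.20:L17-25).

No `sorry`; no named fact; definitions = the three printed objects `e(φ)`/`e′(φ)`, `γ`, `B` and the
normal field.  Typer lint: no `instance`, no `notation`.
-/

noncomputable section

open Metric Set
open scoped InnerProductSpace ComplexConjugate

namespace Literature.MathematicalPhysics.QuantumLattice.FermiRG

namespace FST4

/-! ### A. A Sturm comparison lemma -/

/-- **Sturm comparison** (proof device for Blaschke's rolling theorem in the plane): if `g` is twice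
differentiable with `g″ + g = f` continuous and nonnegative, and `g(a) = g′(a) = 0`, then `g ≥ 0` on
`[a − π, a + π]`.  Proof: `g(ψ) = ∫ₐ^ψ sin(ψ − s) f(s) ds` (the difference has conserved energy
`D² + D′²`, zero at `a`), and the integrand has a sign for `|ψ − a| ≤ π`.
[cite: FeldmanSalmhoferTrubowitz2000, Lemma 1 (proof device, d = 2) App. p.19:L18-p.20:L31] -/
theorem sturm_nonneg {g g₁ g₂ f : ℝ → ℝ} {a : ℝ} (hg : ∀ x, HasDerivAt g (g₁ x) x)
    (hg₁ : ∀ x, HasDerivAt g₁ (g₂ x) x) (hf : Continuous f) (hfe : ∀ x, g₂ x + g x = f x)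
    (hf0 : ∀ x, 0 ≤ f x) (h0 : g a = 0) (h1 : g₁ a = 0) :
    ∀ ψ ∈ Icc (a - Real.pi) (a + Real.pi), 0 ≤ g ψ := by
  -- the explicit solution `G = sin · A − cos · Bf`, `A = ∫ cos f`, `Bf = ∫ sin f`
  have hcf : Continuous fun s => Real.cos s * f s := Real.continuous_cos.mul hf
  have hsf : Continuous fun s => Real.sin s * f s := Real.continuous_sin.mul hf
  obtain ⟨A, hA⟩ : ∃ A : ℝ → ℝ, A = fun ψ => ∫ s in a..ψ, Real.cos s * f s := ⟨_, rfl⟩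
  obtain ⟨Bf, hBf⟩ : ∃ Bf : ℝ → ℝ, Bf = fun ψ => ∫ s in a..ψ, Real.sin s * f s := ⟨_, rfl⟩
  have hA' : ∀ ψ, HasDerivAt A (Real.cos ψ * f ψ) ψ := fun ψ => by
    rw [hA]
    exact intervalIntegral.integral_hasDerivAt_right (hcf.intervalIntegrable _ _)
      (hcf.stronglyMeasurableAtFilter _ _) hcf.continuousAt
  have hBf' : ∀ ψ, HasDerivAt Bf (Real.sin ψ * f ψ) ψ := fun ψ => by
    rw [hBf]
    exact intervalIntegral.integral_hasDerivAt_right (hsf.intervalIntegrable _ _)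
      (hsf.stronglyMeasurableAtFilter _ _) hsf.continuousAt
  obtain ⟨G, hG⟩ : ∃ G : ℝ → ℝ, G = fun ψ => Real.sin ψ * A ψ - Real.cos ψ * Bf ψ := ⟨_, rfl⟩
  obtain ⟨G₁, hG₁⟩ : ∃ G₁ : ℝ → ℝ, G₁ = fun ψ => Real.cos ψ * A ψ + Real.sin ψ * Bf ψ := ⟨_, rfl⟩
  have hGd : ∀ ψ, HasDerivAt G (G₁ ψ) ψ := by
    intro ψ
    have h2 : HasDerivAt (fun x => Real.sin x * A x - Real.cos x * Bf x)
        (Real.cos ψ * A ψ + Real.sin ψ * (Real.cos ψ * f ψ)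
          - (-Real.sin ψ * Bf ψ + Real.cos ψ * (Real.sin ψ * f ψ))) ψ :=
      ((Real.hasDerivAt_sin ψ).mul (hA' ψ)).sub ((Real.hasDerivAt_cos ψ).mul (hBf' ψ))
    rw [hG, hG₁]
    refine h2.congr_deriv ?_
    simp only
    ring
  have hG₁d : ∀ ψ, HasDerivAt G₁ (-G ψ + f ψ) ψ := by
    intro ψ
    have h2 : HasDerivAt (fun x => Real.cos x * A x + Real.sin x * Bf x)
        (-Real.sin ψ * A ψ + Real.cos ψ * (Real.cos ψ * f ψ)
          + (Real.cos ψ * Bf ψ + Real.sin ψ * (Real.sin ψ * f ψ))) ψ :=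
      ((Real.hasDerivAt_cos ψ).mul (hA' ψ)).add ((Real.hasDerivAt_sin ψ).mul (hBf' ψ))
    rw [hG₁]
    refine h2.congr_deriv ?_
    rw [hG]
    have h3 := Real.sin_sq_add_cos_sq ψ
    simp only
    linear_combination (f ψ) * h3
  -- uniqueness: the energy of `g − G` is conserved and vanishes at `a`
  have hAa : A a = 0 := by rw [hA]; simp
  have hBa : Bf a = 0 := by rw [hBf]; simp
  have hGa : G a = 0 := by rw [hG]; simp [hAa, hBa]
  have hG₁a : G₁ a = 0 := by rw [hG₁]; simp [hAa, hBa]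
  obtain ⟨E, hE⟩ : ∃ E : ℝ → ℝ, E = fun ψ => (g ψ - G ψ) ^ 2 + (g₁ ψ - G₁ ψ) ^ 2 := ⟨_, rfl⟩
  have hEd : ∀ ψ, HasDerivAt E 0 ψ := by
    intro ψ
    have h2 : HasDerivAt (fun x => (g x - G x) ^ 2 + (g₁ x - G₁ x) ^ 2)
        (((2 : ℕ) : ℝ) * (g ψ - G ψ) ^ (2 - 1) * (g₁ ψ - G₁ ψ)
          + ((2 : ℕ) : ℝ) * (g₁ ψ - G₁ ψ) ^ (2 - 1) * (g₂ ψ - (-G ψ + f ψ))) ψ :=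
      (((hg ψ).sub (hGd ψ)).pow 2).add (((hg₁ ψ).sub (hG₁d ψ)).pow 2)
    rw [hE]
    refine h2.congr_deriv ?_
    have h3 := hfe ψ
    push_cast
    linear_combination (2 : ℝ) * (g₁ ψ - G₁ ψ) * h3
  have hEconst : ∀ ψ, E ψ = E a := fun ψ =>
    is_const_of_deriv_eq_zero (fun x => (hEd x).differentiableAt) (fun x => (hEd x).deriv) ψ a
  have hEa : E a = 0 := by rw [hE]; simp [h0, h1, hGa, hG₁a]
  have hgG : ∀ ψ, g ψ = G ψ := by
    intro ψ
    have h2 := hEconst ψ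
    rw [hEa, hE] at h2
    have h3 : (g ψ - G ψ) ^ 2 = 0 := by nlinarith [sq_nonneg (g ψ - G ψ), sq_nonneg (g₁ ψ - G₁ ψ)]
    exact sub_eq_zero.1 (pow_eq_zero_iff two_ne_zero |>.1 h3)
  -- the explicit solution has a sign on `[a − π, a + π]`
  intro ψ hψ
  rw [hgG ψ]
  have hGint : G ψ = ∫ s in a..ψ, Real.sin (ψ - s) * f s := by
    rw [hG, hA, hBf]
    simp only
    rw [← intervalIntegral.integral_const_mul, ← intervalIntegral.integral_const_mul,
      ← intervalIntegral.integral_sub ((hcf.const_mul _).intervalIntegrable _ _)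
        ((hsf.const_mul _).intervalIntegrable _ _)]
    congr 1
    ext s
    rw [Real.sin_sub]
    ring
  rw [hGint]
  rcases le_total a ψ with haψ | hψa
  · apply intervalIntegral.integral_nonneg haψ
    intro s hs
    have h2 : 0 ≤ Real.sin (ψ - s) :=
      Real.sin_nonneg_of_nonneg_of_le_pi (by linarith [hs.2]) (by linarith [hψ.2, hs.1])
    exact mul_nonneg h2 (hf0 s)
  · rw [intervalIntegral.integral_symm, ← intervalIntegral.integral_neg]
    apply intervalIntegral.integral_nonneg hψa
    intro s hs
    have h2 : 0 ≤ Real.sin (s - ψ) :=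
      Real.sin_nonneg_of_nonneg_of_le_pi (by linarith [hs.1]) (by linarith [hψ.1, hs.2])
    have h3 : -(Real.sin (ψ - s) * f s) = Real.sin (s - ψ) * f s := by
      rw [← neg_sub s ψ, Real.sin_neg]
      ring
    rw [h3]
    exact mul_nonneg h2 (hf0 s)

/-- Periodic extension of the Sturm comparison: if moreover `g` is `2π`-periodic, then `g ≥ 0`
everywhere. [cite: FeldmanSalmhoferTrubowitz2000, Lemma 1 (proof device, d = 2) App. p.19:L18-p.20:L31] -/
theorem sturm_nonneg_of_periodic {g g₁ g₂ f : ℝ → ℝ} {a : ℝ} (hg : ∀ x, HasDerivAt g (g₁ x) x)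
    (hg₁ : ∀ x, HasDerivAt g₁ (g₂ x) x) (hf : Continuous f) (hfe : ∀ x, g₂ x + g x = f x)
    (hf0 : ∀ x, 0 ≤ f x) (h0 : g a = 0) (h1 : g₁ a = 0)
    (hper : Function.Periodic g (2 * Real.pi)) : ∀ ψ, 0 ≤ g ψ := by
  intro ψ
  have h2p : (0 : ℝ) < 2 * Real.pi := by positivity
  have hmem := toIcoMod_mem_Ico h2p (a - Real.pi) ψ
  have heq : g ψ = g (toIcoMod h2p (a - Real.pi) ψ) := by
    rw [← self_sub_toIcoDiv_zsmul h2p (a - Real.pi) ψ]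
    exact (hper.sub_zsmul_eq _).symm
  rw [heq]
  refine sturm_nonneg hg hg₁ hf hfe hf0 h0 h1 _ ⟨hmem.1, ?_⟩
  have := hmem.2
  linarith

/-! ### B. Plane vectors (`ℝ² ≅ ℂ` with its real inner product `⟪z, w⟫ = Re(z̄w)`) -/

/-- The outward normal direction `e(ψ) = (cos ψ, sin ψ) = e^{iψ}`.
[cite: FeldmanSalmhoferTrubowitz2000, Lemma 1 (d = 2: the normal `n(p)`) §2.1 p.6:L46-49] -/
def unitVec (ψ : ℝ) : ℂ := Complex.exp (ψ * Complex.I)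

/-- The tangent direction `e′(ψ) = (−sin ψ, cos ψ) = i e^{iψ}`.
[cite: FeldmanSalmhoferTrubowitz2000, Lemma 1 (d = 2: tangent direction) §2.1 p.6:L46-49] -/
def unitVec' (ψ : ℝ) : ℂ := Complex.I * unitVec ψ

/-- `Re e(ψ) = cos ψ`. [cite: FeldmanSalmhoferTrubowitz2000, Lemma 1 (d = 2) §2.1 p.6:L46-49] -/
theorem unitVec_re (ψ : ℝ) : (unitVec ψ).re = Real.cos ψ := Complex.exp_ofReal_mul_I_re ψ

/-- `Im e(ψ) = sin ψ`. [cite: FeldmanSalmhoferTrubowitz2000, Lemma 1 (d = 2) §2.1 p.6:L46-49] -/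
theorem unitVec_im (ψ : ℝ) : (unitVec ψ).im = Real.sin ψ := Complex.exp_ofReal_mul_I_im ψ

/-- `Re e′(ψ) = −sin ψ`. [cite: FeldmanSalmhoferTrubowitz2000, Lemma 1 (d = 2) §2.1 p.6:L46-49] -/
theorem unitVec'_re (ψ : ℝ) : (unitVec' ψ).re = -Real.sin ψ := by
  simp [unitVec', Complex.mul_re, unitVec_re, unitVec_im]

/-- `Im e′(ψ) = cos ψ`. [cite: FeldmanSalmhoferTrubowitz2000, Lemma 1 (d = 2) §2.1 p.6:L46-49] -/
theorem unitVec'_im (ψ : ℝ) : (unitVec' ψ).im = Real.cos ψ := by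
  simp [unitVec', Complex.mul_im, unitVec_re, unitVec_im]

/-- `‖e(ψ)‖ = 1`. [cite: FeldmanSalmhoferTrubowitz2000, Lemma 1 (d = 2) §2.1 p.6:L46-49] -/
theorem norm_unitVec (ψ : ℝ) : ‖unitVec ψ‖ = 1 := Complex.norm_exp_ofReal_mul_I ψ

/-- `e` is `2π`-periodic. [cite: FeldmanSalmhoferTrubowitz2000, Lemma 1 (d = 2) §2.1 p.6:L46-49] -/
theorem unitVec_add_two_pi (ψ : ℝ) : unitVec (ψ + 2 * Real.pi) = unitVec ψ := by
  apply Complex.ext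
  · rw [unitVec_re, unitVec_re, Real.cos_add_two_pi]
  · rw [unitVec_im, unitVec_im, Real.sin_add_two_pi]

/-- `⟪x, e(ψ)⟫ = x₁ cos ψ + x₂ sin ψ`. [cite: FeldmanSalmhoferTrubowitz2000, Lemma 1 (d = 2) §2.1 p.6:L46-49] -/
theorem inner_unitVec (x : ℂ) (ψ : ℝ) :
    ⟪x, unitVec ψ⟫_ℝ = x.re * Real.cos ψ + x.im * Real.sin ψ := by
  rw [Complex.inner, Complex.mul_re, Complex.conj_re, Complex.conj_im, unitVec_re, unitVec_im]
  ring

/-- `⟪x, e′(ψ)⟫ = −x₁ sin ψ + x₂ cos ψ`. [cite: FeldmanSalmhoferTrubowitz2000, Lemma 1 (d = 2) §2.1 p.6:L46-49] -/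
theorem inner_unitVec' (x : ℂ) (ψ : ℝ) :
    ⟪x, unitVec' ψ⟫_ℝ = -x.re * Real.sin ψ + x.im * Real.cos ψ := by
  rw [Complex.inner, Complex.mul_re, Complex.conj_re, Complex.conj_im, unitVec'_re, unitVec'_im]
  ring

/-- `⟪e(φ), e(ψ)⟫ = cos(ψ − φ)`. [cite: FeldmanSalmhoferTrubowitz2000, Lemma 1 (d = 2) §2.1 p.6:L46-49] -/
theorem inner_unitVec_unitVec (φ ψ : ℝ) : ⟪unitVec φ, unitVec ψ⟫_ℝ = Real.cos (ψ - φ) := by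
  rw [inner_unitVec, unitVec_re, unitVec_im, Real.cos_sub]
  ring

/-- `⟪e′(φ), e(ψ)⟫ = sin(ψ − φ)`. [cite: FeldmanSalmhoferTrubowitz2000, Lemma 1 (d = 2) §2.1 p.6:L46-49] -/
theorem inner_unitVec'_unitVec (φ ψ : ℝ) : ⟪unitVec' φ, unitVec ψ⟫_ℝ = Real.sin (ψ - φ) := by
  rw [inner_unitVec, unitVec'_re, unitVec'_im, Real.sin_sub]
  ring

/-- A plane vector is determined by its components along `e(ψ)`, `e′(ψ)`:
`x = ⟪x, e(ψ)⟫ e(ψ) + ⟪x, e′(ψ)⟫ e′(ψ)`.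
[cite: FeldmanSalmhoferTrubowitz2000, Lemma 1 (d = 2) §2.1 p.6:L46-49] -/
theorem eq_smul_unitVec_add (x : ℂ) (ψ : ℝ) :
    x = (⟪x, unitVec ψ⟫_ℝ) • unitVec ψ + (⟪x, unitVec' ψ⟫_ℝ) • unitVec' ψ := by
  have h3 := Real.sin_sq_add_cos_sq ψ
  apply Complex.ext
  · simp only [Complex.add_re, Complex.real_smul, Complex.re_ofReal_mul, inner_unitVec,
      inner_unitVec', unitVec_re, unitVec'_re]
    linear_combination (-(x.re)) * h3
  · simp only [Complex.add_im, Complex.real_smul, Complex.im_ofReal_mul, inner_unitVec,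
      inner_unitVec', unitVec_im, unitVec'_im]
    linear_combination (-(x.im)) * h3

/-- Every nonzero plane vector is `‖w‖ e(ψ)` for some `ψ` (polar form).
[cite: FeldmanSalmhoferTrubowitz2000, Lemma 1 (d = 2) §2.1 p.6:L46-49] -/
theorem exists_eq_norm_smul_unitVec (w : ℂ) : ∃ ψ : ℝ, w = ‖w‖ • unitVec ψ :=
  ⟨Complex.arg w, by rw [unitVec, Complex.real_smul]; exact (Complex.norm_mul_exp_arg_mul_I w).symm⟩

/-- If `⟪w, e(ψ)⟫ ≤ r` for every direction `ψ`, then `‖w‖ ≤ r`.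
[cite: FeldmanSalmhoferTrubowitz2000, Lemma 1 (d = 2) §2.1 p.6:L46-49] -/
theorem norm_le_of_inner_unitVec_le {w : ℂ} {r : ℝ} (h : ∀ ψ, ⟪w, unitVec ψ⟫_ℝ ≤ r) : ‖w‖ ≤ r := by
  obtain ⟨ψ, hψ⟩ := exists_eq_norm_smul_unitVec w
  have h1 := h ψ
  rw [hψ, real_inner_smul_left, real_inner_self_eq_norm_sq, norm_unitVec] at h1
  rw [hψ, norm_smul, Real.norm_of_nonneg (norm_nonneg w), norm_unitVec]
  simpa using h1


/-! ### C. The support-function curve `γ`, the body `B`, and the support inequalities -/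

section Curve

variable (h : ℝ → ℝ)

/-- **The curve parametrised by its normal angle**: `γ(φ) = h(φ) e(φ) + h′(φ) e′(φ)` (`h` the support
function; for a `C²` closed convex curve with positive curvature this is the inverse of the Gauss map,
and `γ′ = (h + h″) e′`, so `h + h″` is the radius of curvature).
[cite: FeldmanSalmhoferTrubowitz2000, Lemma 1 (d = 2: the surface `S`) §2.1 p.6:L29-33] -/
def supportCurve (φ : ℝ) : ℂ := (h φ) • unitVec φ + (deriv h φ) • unitVec' φ

/-- **The closed region bounded by the curve**, as the intersection of its supporting half-planes:
`B = {x : ⟪x, e(ψ)⟫ ≤ h(ψ) for all ψ}`.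
[cite: FeldmanSalmhoferTrubowitz2000, Lemma 1 (d = 2: the region inside `S`) §2.1 p.6:L29-33; App. p.19:L5-7] -/
def supportBody : Set ℂ := {x | ∀ ψ : ℝ, ⟪x, unitVec ψ⟫_ℝ ≤ h ψ}

/-- **The outward normal field** on the curve: at `p = γ(φ)` it is `e(φ)` (some `φ` with `γ(φ) = p`,
chosen; the choice is immaterial by `supportNormal_supportCurve`); off the curve the junk value `0`
(never met: the rolling-ball structure only evaluates `n` on `frontier B = range γ`).
[cite: FeldmanSalmhoferTrubowitz2000, Lemma 1 (d = 2: the normal `n(p)`) §2.1 p.6:L46-49] -/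
def supportNormal (p : ℂ) : ℂ :=
  letI := Classical.propDecidable (∃ φ : ℝ, supportCurve h φ = p)
  if hp : ∃ φ : ℝ, supportCurve h φ = p then unitVec hp.choose else 0

/-- `⟪γ(φ), e(ψ)⟫ = h(φ) cos(ψ − φ) + h′(φ) sin(ψ − φ)`.
[cite: FeldmanSalmhoferTrubowitz2000, Lemma 1 (d = 2) §2.1 p.6:L29-33] -/
theorem inner_supportCurve_unitVec (φ ψ : ℝ) :
    ⟪supportCurve h φ, unitVec ψ⟫_ℝ = h φ * Real.cos (ψ - φ) + deriv h φ * Real.sin (ψ - φ) := by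
  rw [supportCurve, inner_add_left, real_inner_smul_left, real_inner_smul_left, inner_unitVec_unitVec,
    inner_unitVec'_unitVec]

/-- `⟪γ(φ), e(φ)⟫ = h(φ)`: `h` IS the support function of the curve in the direction `e(φ)`.
[cite: FeldmanSalmhoferTrubowitz2000, Lemma 1 (d = 2) §2.1 p.6:L29-33] -/
theorem inner_supportCurve_unitVec_self (φ : ℝ) : ⟪supportCurve h φ, unitVec φ⟫_ℝ = h φ := by
  rw [inner_supportCurve_unitVec, sub_self, Real.cos_zero, Real.sin_zero]
  ring

/-- The normal field at a point of the curve is `e` of a chosen preimage angle.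
[cite: FeldmanSalmhoferTrubowitz2000, Lemma 1 (d = 2) §2.1 p.6:L46-49] -/
theorem supportNormal_of_exists {p : ℂ} (hp : ∃ φ : ℝ, supportCurve h φ = p) :
    supportNormal h p = unitVec hp.choose := by
  rw [supportNormal]
  exact dif_pos hp

/-- `B` is closed (an intersection of closed half-planes).
[cite: FeldmanSalmhoferTrubowitz2000, Lemma 1 (d = 2) §2.1 p.6:L29-33] -/
theorem isClosed_supportBody : IsClosed (supportBody h) := by
  rw [supportBody, setOf_forall]
  exact isClosed_iInter fun ψ => isClosed_le (continuous_id.inner continuous_const) continuous_const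

/-- `B` is convex (an intersection of half-planes) — "`S` is convex".
[cite: FeldmanSalmhoferTrubowitz2000, Lemma 1 (d = 2: convexity) §2.1 p.6:L29-33] -/
theorem convex_supportBody : Convex ℝ (supportBody h) := by
  intro x hx y hy a b ha hb hab ψ
  rw [inner_add_left, real_inner_smul_left, real_inner_smul_left]
  calc a * ⟪x, unitVec ψ⟫_ℝ + b * ⟪y, unitVec ψ⟫_ℝ ≤ a * h ψ + b * h ψ :=
        add_le_add (mul_le_mul_of_nonneg_left (hx ψ) ha) (mul_le_mul_of_nonneg_left (hy ψ) hb)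
    _ = h ψ := by rw [← add_mul, hab, one_mul]

/-- The frontier of the closed set `B` lies in `B`. [cite: FeldmanSalmhoferTrubowitz2000, Lemma 1 (d = 2) §2.1 p.6:L29-33] -/
theorem frontier_supportBody_subset : frontier (supportBody h) ⊆ supportBody h := by
  intro p hp
  have h1 := frontier_subset_closure hp
  rwa [(isClosed_supportBody h).closure_eq] at h1

/-- `C²` regularity unpacked: `h′ = deriv h` and `h″ = iteratedDeriv 2 h` are honest derivatives, and
`h`, `h″` are continuous. [cite: FeldmanSalmhoferTrubowitz2000, Lemma 1 (d = 2: `C²`) §2.1 p.6:L29-33] -/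
theorem hasDerivAt_of_contDiff_two (hh : ContDiff ℝ 2 h) (x : ℝ) :
    HasDerivAt h (deriv h x) x ∧ HasDerivAt (deriv h) (iteratedDeriv 2 h x) x := by
  have hh' : ContDiff ℝ (2 : ℕ) h := by simpa using hh
  have h0 := (contDiff_nat_iff_iteratedDeriv.1 hh').2 0 (by norm_num)
  have h1 := (contDiff_nat_iff_iteratedDeriv.1 hh').2 1 (by norm_num)
  rw [iteratedDeriv_zero] at h0
  rw [iteratedDeriv_one] at h1
  refine ⟨(h0 x).hasDerivAt, ?_⟩
  have h2 : iteratedDeriv 2 h = deriv (deriv h) := by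
    rw [show (2 : ℕ) = 1 + 1 from rfl, iteratedDeriv_succ, iteratedDeriv_one]
  rw [h2]
  exact (h1 x).hasDerivAt

/-- Continuity of `h″`. [cite: FeldmanSalmhoferTrubowitz2000, Lemma 1 (d = 2: `C²`) §2.1 p.6:L29-33] -/
theorem continuous_iteratedDeriv_two (hh : ContDiff ℝ 2 h) : Continuous (iteratedDeriv 2 h) := by
  have hh' : ContDiff ℝ (2 : ℕ) h := by simpa using hh
  exact (contDiff_nat_iff_iteratedDeriv.1 hh').1 2 le_rfl

/-- **The support inequality from a LOWER curvature-radius bound** (inner comparison): if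
`r ≤ h + h″` everywhere, then `⟪γ(φ), e(ψ)⟫ + r(1 − cos(ψ − φ)) ≤ h(ψ)` for all `φ, ψ` — the support
function of the ball of radius `r` touching the curve at `γ(φ)` from inside stays below `h`.  Sturm
comparison applied to `g(ψ) = h(ψ) − ⟪γ(φ), e(ψ)⟫ − r(1 − cos(ψ − φ))`, `g″ + g = h + h″ − r ≥ 0`.
[cite: FeldmanSalmhoferTrubowitz2000, Lemma 1 (proof, d = 2: `‖p − c‖ ≥ 1/K` side) App. p.19:L18-p.20:L10] -/
theorem supportIneq_inner (hh : ContDiff ℝ 2 h) (hper : Function.Periodic h (2 * Real.pi)) {r : ℝ}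
    (hr : ∀ ψ, r ≤ h ψ + iteratedDeriv 2 h ψ) (φ ψ : ℝ) :
    h φ * Real.cos (ψ - φ) + deriv h φ * Real.sin (ψ - φ) + r * (1 - Real.cos (ψ - φ)) ≤ h ψ := by
  have hd := hasDerivAt_of_contDiff_two h hh
  -- `g`, `g′`, `g″`, `f`
  have key := sturm_nonneg_of_periodic (a := φ)
    (g := fun x => h x - h φ * Real.cos (x - φ) - deriv h φ * Real.sin (x - φ)
      - r * (1 - Real.cos (x - φ)))
    (g₁ := fun x => deriv h x + h φ * Real.sin (x - φ) - deriv h φ * Real.cos (x - φ)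
      - r * Real.sin (x - φ))
    (g₂ := fun x => iteratedDeriv 2 h x + h φ * Real.cos (x - φ) + deriv h φ * Real.sin (x - φ)
      - r * Real.cos (x - φ))
    (f := fun x => h x + iteratedDeriv 2 h x - r) ?_ ?_ ?_ ?_ ?_ ?_ ?_ ?_
  · have h1 := key ψ
    linarith
  · intro x
    have hc : HasDerivAt (fun y => Real.cos (y - φ)) (-Real.sin (x - φ) * 1) x :=
      ((hasDerivAt_id' x).sub_const φ).cos
    have hs : HasDerivAt (fun y => Real.sin (y - φ)) (Real.cos (x - φ) * 1) x :=
      ((hasDerivAt_id' x).sub_const φ).sin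
    have h2 := (((hd x).1.sub (hc.const_mul (h φ))).sub (hs.const_mul (deriv h φ))).sub
      ((hc.const_sub 1).const_mul r)
    refine h2.congr_deriv ?_
    ring
  · intro x
    have hc : HasDerivAt (fun y => Real.cos (y - φ)) (-Real.sin (x - φ) * 1) x :=
      ((hasDerivAt_id' x).sub_const φ).cos
    have hs : HasDerivAt (fun y => Real.sin (y - φ)) (Real.cos (x - φ) * 1) x :=
      ((hasDerivAt_id' x).sub_const φ).sin
    have h2 := (((hd x).2.add (hs.const_mul (h φ))).sub (hc.const_mul (deriv h φ))).sub
      (hs.const_mul r)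
    refine h2.congr_deriv ?_
    ring
  · exact (hh.continuous.add (continuous_iteratedDeriv_two h hh)).sub continuous_const
  · intro x
    ring
  · intro x
    have := hr x
    linarith
  · simp
  · simp
  · intro x
    show _ = _
    have h1 : x + 2 * Real.pi - φ = (x - φ) + 2 * Real.pi := by ring
    simp only [hper x, h1, Real.cos_add_two_pi, Real.sin_add_two_pi]

/-- **The support inequality from an UPPER curvature-radius bound** (outer comparison): if
`h + h″ ≤ r` everywhere, then `h(ψ) ≤ ⟪γ(φ), e(ψ)⟫ + r(1 − cos(ψ − φ))` — `h` stays below the support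
function of the ball of radius `r` touching the curve at `γ(φ)` from inside.
[cite: FeldmanSalmhoferTrubowitz2000, Lemma 1 (proof, d = 2: `‖p − c‖ ≤ 1/k` side) App. p.20:L12-31] -/
theorem supportIneq_outer (hh : ContDiff ℝ 2 h) (hper : Function.Periodic h (2 * Real.pi)) {r : ℝ}
    (hr : ∀ ψ, h ψ + iteratedDeriv 2 h ψ ≤ r) (φ ψ : ℝ) :
    h ψ ≤ h φ * Real.cos (ψ - φ) + deriv h φ * Real.sin (ψ - φ) + r * (1 - Real.cos (ψ - φ)) := by
  have hd := hasDerivAt_of_contDiff_two h hh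
  have key := sturm_nonneg_of_periodic (a := φ)
    (g := fun x => -(h x - h φ * Real.cos (x - φ) - deriv h φ * Real.sin (x - φ)
      - r * (1 - Real.cos (x - φ))))
    (g₁ := fun x => -(deriv h x + h φ * Real.sin (x - φ) - deriv h φ * Real.cos (x - φ)
      - r * Real.sin (x - φ)))
    (g₂ := fun x => -(iteratedDeriv 2 h x + h φ * Real.cos (x - φ) + deriv h φ * Real.sin (x - φ)
      - r * Real.cos (x - φ)))
    (f := fun x => r - (h x + iteratedDeriv 2 h x)) ?_ ?_ ?_ ?_ ?_ ?_ ?_ ?_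
  · have h1 := key ψ
    linarith
  · intro x
    have hc : HasDerivAt (fun y => Real.cos (y - φ)) (-Real.sin (x - φ) * 1) x :=
      ((hasDerivAt_id' x).sub_const φ).cos
    have hs : HasDerivAt (fun y => Real.sin (y - φ)) (Real.cos (x - φ) * 1) x :=
      ((hasDerivAt_id' x).sub_const φ).sin
    have h2 := ((((hd x).1.sub (hc.const_mul (h φ))).sub (hs.const_mul (deriv h φ))).sub
      ((hc.const_sub 1).const_mul r)).neg
    refine h2.congr_deriv ?_
    ring
  · intro x
    have hc : HasDerivAt (fun y => Real.cos (y - φ)) (-Real.sin (x - φ) * 1) x :=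
      ((hasDerivAt_id' x).sub_const φ).cos
    have hs : HasDerivAt (fun y => Real.sin (y - φ)) (Real.cos (x - φ) * 1) x :=
      ((hasDerivAt_id' x).sub_const φ).sin
    have h2 := ((((hd x).2.add (hs.const_mul (h φ))).sub (hc.const_mul (deriv h φ))).sub
      (hs.const_mul r)).neg
    refine h2.congr_deriv ?_
    ring
  · exact continuous_const.sub (hh.continuous.add (continuous_iteratedDeriv_two h hh))
  · intro x
    ring
  · intro x
    have := hr x
    linarith
  · simp
  · simp
  · intro x
    show _ = _
    have h1 : x + 2 * Real.pi - φ = (x - φ) + 2 * Real.pi := by ring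
    simp only [hper x, h1, Real.cos_add_two_pi, Real.sin_add_two_pi]

/-- The curve lies in the body: `⟪γ(φ), e(ψ)⟫ ≤ h(ψ)` (from `0 ≤ h + h″`).
[cite: FeldmanSalmhoferTrubowitz2000, Lemma 1 (d = 2: `S ⊆ B`) §2.1 p.6:L29-33] -/
theorem supportCurve_mem (hh : ContDiff ℝ 2 h) (hper : Function.Periodic h (2 * Real.pi))
    (hρ : ∀ ψ, 0 ≤ h ψ + iteratedDeriv 2 h ψ) (φ : ℝ) : supportCurve h φ ∈ supportBody h := by
  intro ψ
  rw [inner_supportCurve_unitVec]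
  have h1 := supportIneq_inner h hh hper hρ φ ψ
  linarith

/-- **Blaschke's rolling theorem in the plane, inner ball**: if `1/K ≤ h + h″`, the disc of radius
`1/K` touching the curve at `γ(φ)` from inside lies in `B`.
[cite: FeldmanSalmhoferTrubowitz2000, Lemma 1 (proof, d = 2) App. p.19:L18-p.20:L10] -/
theorem closedBall_subset_supportBody (hh : ContDiff ℝ 2 h) (hper : Function.Periodic h (2 * Real.pi))
    {K : ℝ} (hρ : ∀ ψ, K⁻¹ ≤ h ψ + iteratedDeriv 2 h ψ) (φ : ℝ) :
    closedBall (supportCurve h φ - K⁻¹ • unitVec φ) K⁻¹ ⊆ supportBody h := by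
  intro y hy ψ
  rw [mem_closedBall, dist_eq_norm] at hy
  have h1 : ⟪y, unitVec ψ⟫_ℝ = ⟪y - (supportCurve h φ - K⁻¹ • unitVec φ), unitVec ψ⟫_ℝ
      + ⟪supportCurve h φ, unitVec ψ⟫_ℝ - K⁻¹ * ⟪unitVec φ, unitVec ψ⟫_ℝ := by
    rw [inner_sub_left, inner_sub_left, real_inner_smul_left]
    ring
  have h2 : ⟪y - (supportCurve h φ - K⁻¹ • unitVec φ), unitVec ψ⟫_ℝ ≤ K⁻¹ :=
    (real_inner_le_norm _ _).trans (by rw [norm_unitVec, mul_one]; exact hy)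
  rw [h1, inner_supportCurve_unitVec, inner_unitVec_unitVec]
  have h3 := supportIneq_inner h hh hper hρ φ ψ
  linarith

/-- **Blaschke's rolling theorem in the plane, outer ball**: if `h + h″ ≤ 1/k`, the body `B` lies in
the disc of radius `1/k` touching the curve at `γ(φ)` from inside.
[cite: FeldmanSalmhoferTrubowitz2000, Lemma 1 (proof, d = 2) App. p.20:L12-31] -/
theorem supportBody_subset_closedBall (hh : ContDiff ℝ 2 h) (hper : Function.Periodic h (2 * Real.pi))
    {k : ℝ} (hρ : ∀ ψ, h ψ + iteratedDeriv 2 h ψ ≤ k⁻¹) (φ : ℝ) :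
    supportBody h ⊆ closedBall (supportCurve h φ - k⁻¹ • unitVec φ) k⁻¹ := by
  intro x hx
  rw [mem_closedBall, dist_eq_norm]
  apply norm_le_of_inner_unitVec_le
  intro ψ
  rw [inner_sub_left, inner_sub_left, real_inner_smul_left, inner_supportCurve_unitVec,
    inner_unitVec_unitVec]
  have h1 := hx ψ
  have h2 := supportIneq_outer h hh hper hρ φ ψ
  linarith

/-- `B` is compact (closed, and inside an outer disc). [cite: FeldmanSalmhoferTrubowitz2000, Lemma 1 (d = 2) §2.1 p.6:L29-33] -/
theorem isCompact_supportBody (hh : ContDiff ℝ 2 h) (hper : Function.Periodic h (2 * Real.pi))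
    {k : ℝ} (hρ : ∀ ψ, h ψ + iteratedDeriv 2 h ψ ≤ k⁻¹) : IsCompact (supportBody h) :=
  Metric.isCompact_of_isClosed_isBounded (isClosed_supportBody h)
    (isBounded_closedBall.subset (supportBody_subset_closedBall h hh hper hρ 0))

/-! ### D. The frontier of `B` is the curve -/

/-- Points of the curve are frontier points of `B` (moving outward along `e(φ)` leaves `B`).
[cite: FeldmanSalmhoferTrubowitz2000, Lemma 1 (d = 2: `S = ∂B`) §2.1 p.6:L29-33] -/
theorem supportCurve_mem_frontier (hh : ContDiff ℝ 2 h) (hper : Function.Periodic h (2 * Real.pi))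
    (hρ : ∀ ψ, 0 ≤ h ψ + iteratedDeriv 2 h ψ) (φ : ℝ) :
    supportCurve h φ ∈ frontier (supportBody h) := by
  refine ⟨subset_closure (supportCurve_mem h hh hper hρ φ), fun hint => ?_⟩
  obtain ⟨ε, hε, hball⟩ := Metric.mem_nhds_iff.1 (mem_interior_iff_mem_nhds.1 hint)
  have hy : supportCurve h φ + (ε / 2) • unitVec φ ∈ supportBody h := by
    apply hball
    rw [mem_ball, dist_eq_norm, add_sub_cancel_left, norm_smul, norm_unitVec, mul_one,
      Real.norm_of_nonneg (by positivity : (0 : ℝ) ≤ ε / 2)]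
    linarith
  have h1 := hy φ
  rw [inner_add_left, inner_supportCurve_unitVec_self, real_inner_smul_left,
    real_inner_self_eq_norm_sq, norm_unitVec] at h1
  linarith

/-- **Every frontier point of `B` is a point of the curve**: for `p ∈ ∂B` the nonnegative periodic
function `ψ ↦ h(ψ) − ⟪p, e(ψ)⟫` has minimum `0` (else `p` would be interior), at a minimiser `ψ₀` its
derivative vanishes, and `⟪p, e(ψ₀)⟫ = h(ψ₀)`, `⟪p, e′(ψ₀)⟫ = h′(ψ₀)` say `p = γ(ψ₀)`.
[cite: FeldmanSalmhoferTrubowitz2000, Lemma 1 (d = 2: `∂B ⊆ S`) §2.1 p.6:L29-33] -/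
theorem exists_supportCurve_eq_of_mem_frontier (hh : ContDiff ℝ 2 h)
    (hper : Function.Periodic h (2 * Real.pi)) {p : ℂ} (hp : p ∈ frontier (supportBody h)) :
    ∃ φ : ℝ, supportCurve h φ = p := by
  have hpB : p ∈ supportBody h := frontier_supportBody_subset h hp
  have hd := hasDerivAt_of_contDiff_two h hh
  obtain ⟨Φ, hΦ⟩ : ∃ Φ : ℝ → ℝ, Φ = fun ψ => h ψ - (p.re * Real.cos ψ + p.im * Real.sin ψ) :=
    ⟨_, rfl⟩
  have hΦval : ∀ ψ, Φ ψ = h ψ - ⟪p, unitVec ψ⟫_ℝ := fun ψ => by rw [hΦ, inner_unitVec]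
  have hΦcont : Continuous Φ := by
    rw [hΦ]
    fun_prop
  have hΦper : Function.Periodic Φ (2 * Real.pi) := fun ψ => by
    rw [hΦval, hΦval, hper ψ, unitVec_add_two_pi]
  have hΦnn : ∀ ψ, 0 ≤ Φ ψ := fun ψ => by
    rw [hΦval]
    have := hpB ψ
    linarith
  -- a global minimiser, from a minimiser on one period
  have h2p : (0 : ℝ) < 2 * Real.pi := by positivity
  obtain ⟨ψ₀, -, hmin0⟩ := (isCompact_Icc : IsCompact (Icc (0 : ℝ) (0 + 2 * Real.pi))).exists_isMinOn
    (nonempty_Icc.2 (by linarith)) hΦcont.continuousOn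
  have hmin : ∀ ψ, Φ ψ₀ ≤ Φ ψ := by
    intro ψ
    have hmem := toIcoMod_mem_Ico h2p 0 ψ
    have heq : Φ ψ = Φ (toIcoMod h2p 0 ψ) := by
      rw [← self_sub_toIcoDiv_zsmul h2p 0 ψ]
      exact (hΦper.sub_zsmul_eq _).symm
    rw [heq]
    exact (isMinOn_iff.1 hmin0) _ ⟨hmem.1, hmem.2.le⟩
  -- the minimum is `0`, otherwise `p` is an interior point
  have hΦ0 : Φ ψ₀ = 0 := by
    by_contra hne
    have hpos : 0 < Φ ψ₀ := lt_of_le_of_ne (hΦnn ψ₀) (Ne.symm hne)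
    apply hp.2
    rw [mem_interior_iff_mem_nhds, Metric.mem_nhds_iff]
    refine ⟨Φ ψ₀, hpos, fun y hy ψ => ?_⟩
    rw [mem_ball, dist_eq_norm] at hy
    have h1 : ⟪y, unitVec ψ⟫_ℝ = ⟪p, unitVec ψ⟫_ℝ + ⟪y - p, unitVec ψ⟫_ℝ := by
      rw [inner_sub_left]
      ring
    have h2 : ⟪y - p, unitVec ψ⟫_ℝ ≤ ‖y - p‖ :=
      (real_inner_le_norm _ _).trans (by rw [norm_unitVec, mul_one])
    have h3 := hmin ψ
    rw [hΦval ψ] at h3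
    linarith
  -- at the minimiser the derivative vanishes
  have hΦd : HasDerivAt Φ (deriv h ψ₀ - (p.re * -Real.sin ψ₀ + p.im * Real.cos ψ₀)) ψ₀ := by
    rw [hΦ]
    exact (hd ψ₀).1.sub (((Real.hasDerivAt_cos ψ₀).const_mul p.re).add
      ((Real.hasDerivAt_sin ψ₀).const_mul p.im))
  have hloc : IsLocalMin Φ ψ₀ := Filter.Eventually.of_forall fun ψ => hmin ψ
  have hd0 := hloc.hasDerivAt_eq_zero hΦd
  -- read off `⟪p, e(ψ₀)⟫ = h(ψ₀)`, `⟪p, e′(ψ₀)⟫ = h′(ψ₀)`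
  have ha : ⟪p, unitVec ψ₀⟫_ℝ = h ψ₀ := by
    have h1 := hΦval ψ₀
    rw [hΦ0] at h1
    linarith
  have hb : ⟪p, unitVec' ψ₀⟫_ℝ = deriv h ψ₀ := by
    rw [inner_unitVec']
    linarith
  refine ⟨ψ₀, ?_⟩
  rw [supportCurve, ← ha, ← hb]
  exact (eq_smul_unitVec_add p ψ₀).symm

/-- **`frontier B = S`**: the boundary of the body is exactly the curve.
[cite: FeldmanSalmhoferTrubowitz2000, Lemma 1 (d = 2: `S = ∂B`) §2.1 p.6:L29-33] -/
theorem frontier_supportBody (hh : ContDiff ℝ 2 h) (hper : Function.Periodic h (2 * Real.pi))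
    (hρ : ∀ ψ, 0 ≤ h ψ + iteratedDeriv 2 h ψ) :
    frontier (supportBody h) = range (supportCurve h) := by
  ext p
  constructor
  · intro hp
    obtain ⟨φ, hφ⟩ := exists_supportCurve_eq_of_mem_frontier h hh hper hp
    exact ⟨φ, hφ⟩
  · rintro ⟨φ, rfl⟩
    exact supportCurve_mem_frontier h hh hper hρ φ

/-! ### E. The rolling-ball structure and Lemma 1 for plane curves -/

/-- **Blaschke's rolling theorem for plane curves, packaged**: for `h ∈ C²`, `2π`-periodic, with
`1/K ≤ h + h″ ≤ 1/k` (`0 < k ≤ K`), the body `B = supportBody h` with the normal field `supportNormal h`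
is a `RollingConvexBody k K` — the hypothesis class of `FST4.lemma1`.
[cite: FeldmanSalmhoferTrubowitz2000, Lemma 1 (hypotheses, d = 2) §2.1 p.6:L29-33; App. p.19:L19-20] -/
theorem rollingConvexBody_supportBody {k K : ℝ} (hk : 0 < k) (hkK : k ≤ K) (hh : ContDiff ℝ 2 h)
    (hper : Function.Periodic h (2 * Real.pi)) (hρK : ∀ ψ, K⁻¹ ≤ h ψ + iteratedDeriv 2 h ψ)
    (hρk : ∀ ψ, h ψ + iteratedDeriv 2 h ψ ≤ k⁻¹) :
    RollingConvexBody k K (supportBody h) (supportNormal h) where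
  k_pos := hk
  k_le := hkK
  isCompact := isCompact_supportBody h hh hper hρk
  convex := convex_supportBody h
  norm_normal := fun p hp => by
    rw [supportNormal_of_exists h (exists_supportCurve_eq_of_mem_frontier h hh hper hp), norm_unitVec]
  inner_ball := fun p hp => by
    have hex := exists_supportCurve_eq_of_mem_frontier h hh hper hp
    have key := closedBall_subset_supportBody h hh hper hρK hex.choose
    rw [hex.choose_spec] at key
    rw [supportNormal_of_exists h hex]
    exact key
  outer_ball := fun p hp => by
    have hex := exists_supportCurve_eq_of_mem_frontier h hh hper hp
    have key := supportBody_subset_closedBall h hh hper hρk hex.choose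
    rw [hex.choose_spec] at key
    rw [supportNormal_of_exists h hex]
    exact key

/-- On the curve the normal field IS `e(φ)` (independently of the chosen preimage angle): by the
uniqueness of the rolling normal (`RollingConvexBody.normal_unique`).
[cite: FeldmanSalmhoferTrubowitz2000, Lemma 1 (d = 2: the normal `n(p)`) §2.1 p.6:L46-49] -/
theorem supportNormal_supportCurve {k K : ℝ} (hk : 0 < k) (hkK : k ≤ K) (hh : ContDiff ℝ 2 h)
    (hper : Function.Periodic h (2 * Real.pi)) (hρK : ∀ ψ, K⁻¹ ≤ h ψ + iteratedDeriv 2 h ψ)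
    (hρk : ∀ ψ, h ψ + iteratedDeriv 2 h ψ ≤ k⁻¹) (φ : ℝ) :
    supportNormal h (supportCurve h φ) = unitVec φ := by
  have hB := rollingConvexBody_supportBody h hk hkK hh hper hρK hρk
  have hρ0 : ∀ ψ, 0 ≤ h ψ + iteratedDeriv 2 h ψ :=
    fun ψ => (inv_nonneg.2 (hk.le.trans hkK)).trans (hρK ψ)
  symm
  exact hB.normal_unique (supportCurve_mem_frontier h hh hper hρ0 φ) (norm_unitVec φ)
    (closedBall_subset_supportBody h hh hper hρK φ)

/-- **FST IV Lemma 1 for `C²` convex plane curves with curvature in `[k, K]`** (support-function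
parametrisation `γ = supportCurve h`, `1/K ≤ h + h″ ≤ 1/k`): if `c₁, c₂` are maximally separated
points of the curve `S = range γ` and `c = ½(c₁ + c₂)`, then for every `φ`,
`1/K ≤ ‖γ(φ) − c‖ ≤ 1/k` and `cos θ ≥ k/K`, `θ` the angle between `γ(φ) − c` and the outward normal
`e(φ)`; and if `−p ∈ S` for every `p ∈ S`, then `c = 0`.  (From `FST4.lemma1` and the rolling
theorem above; unconditional in `d = 2`.)
[cite: FeldmanSalmhoferTrubowitz2000, Lemma 1 §2.1 p.6:L29-57; App. p.19:L1-p.20:L34] -/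
theorem lemma1_plane {k K : ℝ} (hk : 0 < k) (hkK : k ≤ K) (hh : ContDiff ℝ 2 h)
    (hper : Function.Periodic h (2 * Real.pi)) (hρK : ∀ ψ, K⁻¹ ≤ h ψ + iteratedDeriv 2 h ψ)
    (hρk : ∀ ψ, h ψ + iteratedDeriv 2 h ψ ≤ k⁻¹) {c₁ c₂ : ℂ}
    (hc : IsMaxSeparated (range (supportCurve h)) c₁ c₂) :
    (∀ φ : ℝ,
        K⁻¹ ≤ ‖supportCurve h φ - midpoint ℝ c₁ c₂‖ ∧ ‖supportCurve h φ - midpoint ℝ c₁ c₂‖ ≤ k⁻¹ ∧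
          k / K ≤ Real.cos (InnerProductGeometry.angle (supportCurve h φ - midpoint ℝ c₁ c₂)
            (unitVec φ))) ∧
      ((∀ p ∈ range (supportCurve h), -p ∈ range (supportCurve h)) → midpoint ℝ c₁ c₂ = 0) := by
  have hB := rollingConvexBody_supportBody h hk hkK hh hper hρK hρk
  have hρ0 : ∀ ψ, 0 ≤ h ψ + iteratedDeriv 2 h ψ :=
    fun ψ => (inv_nonneg.2 (hk.le.trans hkK)).trans (hρK ψ)
  have hfr := frontier_supportBody h hh hper hρ0
  have hc' : IsMaxSeparated (frontier (supportBody h)) c₁ c₂ := by rwa [hfr]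
  have hL := lemma1 hB hc'
  refine ⟨fun φ => ?_, fun hS => hL.2 (by rwa [hfr])⟩
  have hp : supportCurve h φ ∈ frontier (supportBody h) := by
    rw [hfr]
    exact ⟨φ, rfl⟩
  have h1 := hL.1 _ hp
  rw [supportNormal_supportCurve h hk hkK hh hper hρK hρk φ] at h1
  exact h1

/-- The existence form: such a curve has a centre `c` with `1/K ≤ ‖γ(φ) − c‖ ≤ 1/k` and
`⟪γ(φ) − c, e(φ)⟫ ≥ (k/K)‖γ(φ) − c‖` for all `φ` (maximally separated points exist: `S` is compact).
[cite: FeldmanSalmhoferTrubowitz2000, Lemma 1 §2.1 p.6:L29-57] -/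
theorem lemma1_plane_exists_center {k K : ℝ} (hk : 0 < k) (hkK : k ≤ K) (hh : ContDiff ℝ 2 h)
    (hper : Function.Periodic h (2 * Real.pi)) (hρK : ∀ ψ, K⁻¹ ≤ h ψ + iteratedDeriv 2 h ψ)
    (hρk : ∀ ψ, h ψ + iteratedDeriv 2 h ψ ≤ k⁻¹) :
    ∃ c : ℂ, ∀ φ : ℝ, K⁻¹ ≤ ‖supportCurve h φ - c‖ ∧ ‖supportCurve h φ - c‖ ≤ k⁻¹ ∧
      k / K * ‖supportCurve h φ - c‖ ≤ ⟪supportCurve h φ - c, unitVec φ⟫_ℝ := by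
  have hB := rollingConvexBody_supportBody h hk hkK hh hper hρK hρk
  have hρ0 : ∀ ψ, 0 ≤ h ψ + iteratedDeriv 2 h ψ :=
    fun ψ => (inv_nonneg.2 (hk.le.trans hkK)).trans (hρK ψ)
  have hne : (frontier (supportBody h)).Nonempty := ⟨_, supportCurve_mem_frontier h hh hper hρ0 0⟩
  obtain ⟨c₁, c₂, hc⟩ := exists_isMaxSeparated hB.isCompact hne
  refine ⟨midpoint ℝ c₁ c₂, fun φ => ?_⟩
  have hp := supportCurve_mem_frontier h hh hper hρ0 φ
  have h3 := hB.mul_norm_le_inner_sub_midpoint hc hp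
  rw [supportNormal_supportCurve h hk hkK hh hper hρK hρk φ] at h3
  exact ⟨hB.inv_le_norm_sub_midpoint hc hp, hB.norm_sub_midpoint_le hc (hB.frontier_subset hp), h3⟩


/-! ### F. Centrally symmetric curves (`h(φ + π) = h(φ)`): the form used in the proof of Lemma 2 -/

/-- `e(φ + π) = −e(φ)`. [cite: FeldmanSalmhoferTrubowitz2000, Lemma 1 (d = 2) §2.1 p.6:L46-49] -/
theorem unitVec_add_pi (φ : ℝ) : unitVec (φ + Real.pi) = -unitVec φ := by
  apply Complex.ext
  · rw [unitVec_re, Complex.neg_re, unitVec_re, Real.cos_add_pi]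
  · rw [unitVec_im, Complex.neg_im, unitVec_im, Real.sin_add_pi]

/-- `e′(φ + π) = −e′(φ)`. [cite: FeldmanSalmhoferTrubowitz2000, Lemma 1 (d = 2) §2.1 p.6:L46-49] -/
theorem unitVec'_add_pi (φ : ℝ) : unitVec' (φ + Real.pi) = -unitVec' φ := by
  rw [unitVec', unitVec', unitVec_add_pi, mul_neg]

/-- **A centrally symmetric support function gives a centrally symmetric curve**: if
`h(φ + π) = h(φ)` for all `φ`, then `γ(φ + π) = −γ(φ)`; in particular `−p ∈ S` for every `p ∈ S`
(the symmetric clause of Lemma 1; for the Fermi curve of a symmetric dispersion relation `E(−p) = E(p)`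
as in FST IV's class `𝓔`, App. p.20:L17-19).
[cite: FeldmanSalmhoferTrubowitz2000, Lemma 1 (symmetric clause, d = 2) §2.1 p.6:L54; App. p.20:L17-19] -/
theorem supportCurve_add_pi (hsym : ∀ φ, h (φ + Real.pi) = h φ) (φ : ℝ) :
    supportCurve h (φ + Real.pi) = -supportCurve h φ := by
  have hfun : (fun x => h (x + Real.pi)) = h := funext hsym
  have hd : deriv h (φ + Real.pi) = deriv h φ := by
    rw [← deriv_comp_add_const, hfun]
  rw [supportCurve, supportCurve, hsym φ, hd, unitVec_add_pi, unitVec'_add_pi, smul_neg, smul_neg,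
    neg_add]

/-- **Lemma 1 for a centrally symmetric `C²` convex plane curve with curvature in `[k, K]`** — the form
in which FST IV uses it (App. p.20:L17-25: "`S_E` is a convex surface that is invariant under inversion
in the origin … By Lemma 1, `∂_r E ≥ ‖∇E‖ (w₀/G₀)/(G₀/g₀)`"): the centre is the origin, so for every `φ`,
`1/K ≤ ‖γ(φ)‖ ≤ 1/k` and the support function dominates the radius, `h(φ) = ⟪γ(φ), e(φ)⟫ ≥ (k/K)‖γ(φ)‖`
(the radial direction is uniformly transversal to the curve: `cos θ ≥ k/K`).
[cite: FeldmanSalmhoferTrubowitz2000, Lemma 1 §2.1 p.6:L29-57; App. p.20:L17-25] -/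
theorem lemma1_plane_symmetric {k K : ℝ} (hk : 0 < k) (hkK : k ≤ K) (hh : ContDiff ℝ 2 h)
    (hper : Function.Periodic h (2 * Real.pi)) (hρK : ∀ ψ, K⁻¹ ≤ h ψ + iteratedDeriv 2 h ψ)
    (hρk : ∀ ψ, h ψ + iteratedDeriv 2 h ψ ≤ k⁻¹) (hsym : ∀ φ, h (φ + Real.pi) = h φ) (φ : ℝ) :
    K⁻¹ ≤ ‖supportCurve h φ‖ ∧ ‖supportCurve h φ‖ ≤ k⁻¹ ∧ k / K * ‖supportCurve h φ‖ ≤ h φ ∧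
      k / K ≤ Real.cos (InnerProductGeometry.angle (supportCurve h φ) (unitVec φ)) := by
  have hB := rollingConvexBody_supportBody h hk hkK hh hper hρK hρk
  have hρ0 : ∀ ψ, 0 ≤ h ψ + iteratedDeriv 2 h ψ :=
    fun ψ => (inv_nonneg.2 (hk.le.trans hkK)).trans (hρK ψ)
  have hfr := frontier_supportBody h hh hper hρ0
  have hne : (frontier (supportBody h)).Nonempty := ⟨_, supportCurve_mem_frontier h hh hper hρ0 0⟩
  obtain ⟨c₁, c₂, hc⟩ := exists_isMaxSeparated hB.isCompact hne
  have hS : ∀ p ∈ frontier (supportBody h), -p ∈ frontier (supportBody h) := by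
    rw [hfr]
    rintro p ⟨φ', rfl⟩
    exact ⟨φ' + Real.pi, supportCurve_add_pi h hsym φ'⟩
  have hc0 : midpoint ℝ c₁ c₂ = 0 := hB.midpoint_eq_zero hc hS
  have hp := supportCurve_mem_frontier h hh hper hρ0 φ
  have h1 := hB.inv_le_norm_sub_midpoint hc hp
  have h2 := hB.norm_sub_midpoint_le hc (hB.frontier_subset hp)
  have h3 := hB.mul_norm_le_inner_sub_midpoint hc hp
  have h4 := hB.cos_angle_ge hc hp
  rw [hc0, sub_zero] at h1 h2 h3 h4
  rw [supportNormal_supportCurve h hk hkK hh hper hρK hρk φ] at h3 h4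
  rw [inner_supportCurve_unitVec_self] at h3
  exact ⟨h1, h2, h3, h4⟩

end Curve

end FST4

end Literature.MathematicalPhysics.QuantumLattice.FermiRG
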